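import Summits.Ventures.LatticeQCDFlow.Scaling.HubClassStartContentRecursionEnum
import Summits.Ventures.LatticeQCDFlow.Scaling.HubClassGlobalDomination

/-!
HONEST FRAMING: exact (Metropolis-corrected) sampling algorithms for lattice gauge theory; figures
of merit are autocorrelation/cost numbers at stated couplings and volumes; no continuum-physics
claim.

# HubClassGlobalStartContentDeficit — THE START-CONTENT DEFICIT RECURSION, RANK-FREE AND GLOBAL: FOR THE HUB KERNELS OF TWO PROFILES LOWERING ONE CONTENT `t` OF WEIGHT `1` ACROSS
# ANY NUMBER OF OTHER CONTENTS, AT A PRESENT HUB `z` BELOW BOTH POSITIONS OF `t` WITH THREE PARTICLES AT OR ABOVE IT: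
# (P1) `e_{n+1} ≤ e_n·Kh_Y(N;z,z) − γ(β^X_z)ⁿ` AND (P2) `e_n ≤ (β^Y_z)ⁿ − (β^X_z)ⁿ`, `e_n = Kh_Yⁿ(N;z,z) − Kh_Xⁿ(N;z,z)` (lean-2 GEN-42, ours)

Venture-side (OURS).  Cell `lqcd-flow` (pub-lqcd), unit `pub-lqcd-lean-2-g42`, 2026-08-30.  Chapter AB (route (β), the cost side continued), file 4 = file 3 globalised exactly as
Z3 (`hubClass_global_domination`) globalised Z2: two persistence profiles `W^X, W^Y > 0` on a finite content type agreeing off a content `t` with `W^Y_t ≤ W^X_t`, `N(t) = 1`,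
`Σ_vN(v) = K+1`, `K ≥ 2`, chapter W's hub kernels and their powers (hypothesis-equations), a present hub `z ≠ t` with `W_z ≤ W^Y_t`, `W_z < W^X_t` and (`N(z) ≥ 2` or a present
content other than `z, t` AT OR above `W_z` — the tie `W_w = W_z` INCLUDED).  NO condition on the contents between `W^Y_t` and `W^X_t`.

* `global_exists_sorted_enum_first`: a key-sorted enumeration putting a chosen content first among its ties; `global_startClass_base`: no present content strictly between ⇒
  (P1) ∧ (P2) (the enumeration sorted by `W^X + W^Y` with the witness first among its ties — Z3 `global_sorted_of_key` — puts `t` strictly before `z` and three particles at ranks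
  `≤ rank(z)`, a content TIED with `z` included; file 3).
* `global_startClass_chain` (pure algebra): for tag positions `X` above `Z` above `Y` at the hub, (P1) ∧ (P2) for `(X,Z)` and for `(Z,Y)`, `γ_{ZY} ≥ 0` ⇒ (P1) ∧ (P2) for `(X,Y)`
  (`e^{XY} = e^{XZ} + e^{ZY}`, `Kh_Z(z,z) = Kh_Y(z,z) + γ_{ZY}`, and `γ_{ZY}[(β^Zⁿ − β^Xⁿ) − e^{XZ}_n] ≥ 0`).
* **`hubClass_global_startClass_recursion`**: (P1) ∧ (P2) (with `0 ≤ Kh_Y(N;z,z)`, `0 ≤ γ`) for ANY two such profiles — by induction on the number of present contents strictly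
  between `W^Y_t` and `W^X_t` (an intermediate profile with `t` at the persistence of one of them splits the move; both halves keep the hypotheses at `z`).

File 5 moves this to W26's tagged chains of an arbitrary adjacent pair and derives the sharp per-step bound `e_{n+1} ≤ 𝟙{n odd}γqⁿ` and the discounted budget of GEN-41 file 6 (A)
WITHOUT the depth-adjacency proviso.  TOY (`numerics42/global_sharp.py`, exact rationals, NOTHING CLAIMED): 0 ∕ ≈ 12 000 violations.  Literature grade (cell rule): OWN; nothing cited;
no new bib keys.
-/

open Finset

namespace Summit.Ventures.LatticeQCDFlow.Scaling

section GlobalDeficit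
variable {S : Type*} [Fintype S] [DecidableEq S]

/-! ### §1 A sorted enumeration that puts a chosen content first among its ties -/

omit [DecidableEq S] in
/-- **A key-sorted enumeration of the present contents in which a chosen content `w` precedes every other content of key at most `key(w)`** (sort by the key raised at `w` by
half the gap to the next larger key). [ours] -/
theorem global_exists_sorted_enum_first [DecidableEq S] (N : S → ℕ) (f : S → ℝ) (d w : S) :
    ∃ (m : ℕ) (e : ℕ → S), (∀ i j, i < m → j < m → e i = e j → i = j) ∧ (∀ i, i < m → N (e i) ≠ 0) ∧
      (∀ v, N v ≠ 0 → ∃ i, i < m ∧ e i = v) ∧ (∀ i j, i ≤ j → j < m → f (e j) ≤ f (e i)) ∧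
      (∀ i j, i < m → j < m → e i = w → e j ≠ w → f (e j) ≤ f w → i < j) := by
  classical
  -- the gap above `f w`
  set G : Finset S := univ.filter fun v => f w < f v with hG
  obtain ⟨δ, hδ0, hδ⟩ : ∃ δ : ℝ, 0 < δ ∧ ∀ v, f w < f v → f w + 2 * δ ≤ f v := by
    by_cases hne : G.Nonempty
    · refine ⟨(G.inf' hne f - f w) / 2, ?_, fun v hv => ?_⟩
      · obtain ⟨u, hu, hfu⟩ := G.exists_mem_eq_inf' hne f
        have : f w < f u := (mem_filter.mp hu).2
        rw [hfu]; linarith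
      · have : G.inf' hne f ≤ f v := G.inf'_le f (mem_filter.mpr ⟨mem_univ v, hv⟩)
        linarith
    · refine ⟨1, one_pos, fun v hv => ?_⟩
      exact absurd ⟨v, mem_filter.mpr ⟨mem_univ v, hv⟩⟩ hne
  obtain ⟨m, e, he_inj, he_pres, he_cov, hkey⟩ := global_exists_sorted_enum N (fun v => f v + if v = w then δ else 0) d
  refine ⟨m, e, he_inj, he_pres, he_cov, fun i j hij hj => ?_, fun i j hi hj hiw hjw hfj => ?_⟩
  · have hk := hkey i j hij hj
    by_cases hi : e i = w
    · by_cases hj' : e j = w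
      · rw [hi, hj']
      · simp only [hi, if_true, hj', if_false, add_zero] at hk
        -- `f(e j) ≤ f w + δ < f w + 2δ ≤` any key above `f w`
        by_contra hcon
        have hlt : f w < f (e j) := by rw [hi] at hcon; exact not_le.mp hcon
        have := hδ (e j) hlt
        linarith
    · by_cases hj' : e j = w
      · simp only [hi, if_false, hj', if_true, add_zero] at hk
        rw [hj']; linarith
      · simp only [hi, if_false, hj', if_false, add_zero] at hk
        exact hk
  · by_contra hcon
    have hji : j ≤ i := not_lt.mp hcon
    have hk := hkey j i hji hi
    simp only [hiw, if_true, hjw, if_false, add_zero] at hk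
    linarith

/-! ### §1 The base: no present content strictly between -/

/-- **The base of the induction:** no present content strictly between the two persistences of `t` ⇒ (P1) ∧ (P2) at the hub `z`. [ours] -/
theorem global_startClass_base {WX WY : S → ℝ} {accX accY : S → S → ℝ} {KhX KhY : (S → ℕ) → S → S → ℝ} {K : ℕ} {N : S → ℕ} {t z : S}
    {KhnX KhnY : ℕ → S → S → ℝ}
    (hWX : ∀ v, 0 < WX v) (hWY : ∀ v, 0 < WY v) (hagree : ∀ v, v ≠ t → WX v = WY v) (hWt : WY t ≤ WX t)
    (haccX : ∀ h v, accX h v = min 1 (WX h / WX v)) (haccY : ∀ h v, accY h v = min 1 (WY h / WY v)) (hK : 2 ≤ K)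
    (hNK : ∑ v, (N v : ℝ) = K + 1) (hNt : N t = 1)
    (hKXoff : ∀ N' h v, h ≠ v → KhX N' h v = if N' h = 0 then 0 else (N' v : ℝ) / K * accX h v)
    (hKXdiag : ∀ N' h, KhX N' h h = 1 - ∑ v ∈ univ.erase h, KhX N' h v)
    (hKYoff : ∀ N' h v, h ≠ v → KhY N' h v = if N' h = 0 then 0 else (N' v : ℝ) / K * accY h v)
    (hKYdiag : ∀ N' h, KhY N' h h = 1 - ∑ v ∈ univ.erase h, KhY N' h v)
    (hKhnX0 : ∀ h v, KhnX 0 h v = if h = v then 1 else 0) (hKhnXs : ∀ n h v, KhnX (n + 1) h v = ∑ w, KhnX n h w * KhX N w v)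
    (hKhnY0 : ∀ h v, KhnY 0 h v = if h = v then 1 else 0) (hKhnYs : ∀ n h v, KhnY (n + 1) h v = ∑ w, KhnY n h w * KhY N w v)
    (hnone : ∀ v, N v ≠ 0 → v ≠ t → ¬ (WY t < WX v ∧ WX v < WX t))
    (hz : N z ≠ 0) (hzt : z ≠ t) (hzb : WX z ≤ WY t) (hza : WX z < WX t) (hthree : 2 ≤ N z ∨ ∃ w, w ≠ z ∧ w ≠ t ∧ N w ≠ 0 ∧ WX z ≤ WX w) :
    0 ≤ KhY N z z ∧ 0 ≤ KhX N z z - KhY N z z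
      ∧ (∀ n, KhnY (n + 1) z z - KhnX (n + 1) z z
          ≤ (KhnY n z z - KhnX n z z) * KhY N z z - (KhX N z z - KhY N z z) * (KhX N z z - (N z : ℝ) / K) ^ n)
      ∧ (∀ n, KhnY n z z - KhnX n z z ≤ (KhY N z z - (N z : ℝ) / K) ^ n - (KhX N z z - (N z : ℝ) / K) ^ n) := by
  classical
  have hNt0 : N t ≠ 0 := by rw [hNt]; exact one_ne_zero
  -- the witness (if any) is put first among its ties, so that it precedes `z` even when `W_w = W_z`
  obtain ⟨w0, hw0⟩ : ∃ w0 : S, (2 ≤ N z ∨ (w0 ≠ z ∧ w0 ≠ t ∧ N w0 ≠ 0 ∧ WX z ≤ WX w0)) := by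
    rcases hthree with h2 | ⟨w, hw⟩
    · exact ⟨z, Or.inl h2⟩
    · exact ⟨w, Or.inr hw⟩
  obtain ⟨m, e, he_inj, he_pres, he_cov, hkey, hfirst⟩ := global_exists_sorted_enum_first N (fun v => WX v + WY v) t w0
  obtain ⟨hsortX, hsortY⟩ := global_sorted_of_key hagree hWt hnone he_inj he_pres hkey
  obtain ⟨i, hi, hiz⟩ := he_cov z hz
  obtain ⟨s, hs, hst⟩ := he_cov t hNt0
  have hWz : WY z = WX z := (hagree z hzt).symm
  -- the key of `t` exceeds the key of `z`, so `t` is ranked strictly before `z`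
  have hkey_tz : WX z + WY z < WX t + WY t := by rw [hWz]; linarith
  have hsi : s < i := by
    by_contra h
    have h' : i ≤ s := not_lt.mp h
    have := hkey i s h' hs
    rw [hiz, hst] at this
    linarith
  -- three particles at ranks `≤ i`
  have h3 : (3 : ℝ) ≤ ∑ l ∈ range (i + 1), (N (e l) : ℝ) := by
    have hsub2 : ({s, i} : Finset ℕ) ⊆ range (i + 1) := by
      intro l hl
      rcases mem_insert.mp hl with h | h
      · rw [h]; exact mem_range.mpr (by omega)
      · rw [mem_singleton.mp h]; exact mem_range.mpr (by omega)
    have hsi' : s ≠ i := ne_of_lt hsi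
    rcases hw0 with h2 | ⟨hwz, hwt, hw, hzw⟩
    · have hle := sum_le_sum_of_subset_of_nonneg hsub2 (f := fun l => (N (e l) : ℝ)) (fun l _ _ => Nat.cast_nonneg _)
      rw [sum_pair hsi', hst, hiz, hNt] at hle
      have : (2 : ℝ) ≤ N z := by exact_mod_cast h2
      push_cast at hle
      linarith
    · obtain ⟨j, hj, hjw⟩ := he_cov w0 hw
      have hji : j < i := by
        rcases eq_or_lt_of_le hzw with heq | hlt
        · -- the tie: `w0` was put first
          have hzkey : WX z + WY z ≤ WX w0 + WY w0 := by rw [hWz, ← hagree w0 hwt, heq]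
          exact hfirst j i hj hi hjw (by rw [hiz]; exact fun h => hwz (by rw [h])) (by rw [hiz]; exact hzkey)
        · by_contra h
          have h' : i ≤ j := not_lt.mp h
          have := hkey i j h' hj
          rw [hiz, hjw, hWz, ← hagree w0 hwt] at this
          linarith
      have hjs : j ≠ s := fun h => hwt (by rw [← hjw, h, hst])
      have hji' : j ≠ i := ne_of_lt hji
      have hsub3 : ({j, s, i} : Finset ℕ) ⊆ range (i + 1) := by
        intro l hl
        rcases mem_insert.mp hl with h | h
        · rw [h]; exact mem_range.mpr (by omega)
        · exact hsub2 h
      have hle := sum_le_sum_of_subset_of_nonneg hsub3 (f := fun l => (N (e l) : ℝ)) (fun l _ _ => Nat.cast_nonneg _)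
      have hjmem : j ∉ ({s, i} : Finset ℕ) := by
        intro h; rcases mem_insert.mp h with h | h
        · exact hjs h
        · exact hji' (mem_singleton.mp h)
      rw [sum_insert hjmem, sum_pair hsi', hst, hiz, hjw, hNt] at hle
      have h1z : (1 : ℝ) ≤ N z := by exact_mod_cast Nat.one_le_iff_ne_zero.mpr hz
      have h1w : (1 : ℝ) ≤ N w0 := by exact_mod_cast Nat.one_le_iff_ne_zero.mpr hw
      push_cast at hle
      linarith
  exact hubClass_startClass_recursion_of_enum hWX hWY hagree hWt haccX haccY hK hNK hNt hKXoff hKXdiag hKYoff hKYdiag hKhnX0 hKhnXs hKhnY0 hKhnYs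
    he_inj he_pres he_cov hsortX hsortY hi hs hiz hst hsi h3

/-! ### §2 The chaining step (pure algebra) -/

omit [Fintype S] [DecidableEq S] in
/-- **Chaining across an intermediate position of the tag:** (P1) ∧ (P2) for `(X,Z)` and for `(Z,Y)`, `γ_{ZY} ≥ 0`, `Kh_Y(z,z) ≥ 0` ⇒ (P1) ∧ (P2) for `(X,Y)`. [ours] -/
theorem global_startClass_chain {eXZ eZY eXY : ℕ → ℝ} {pX pZ pY ν : ℝ}
    (hsum : ∀ n, eXY n = eXZ n + eZY n) (hY0 : 0 ≤ pY) (hγ1 : 0 ≤ pX - pZ) (hγ2 : 0 ≤ pZ - pY)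
    (h1XZ : ∀ n, eXZ (n + 1) ≤ eXZ n * pZ - (pX - pZ) * (pX - ν) ^ n) (h2XZ : ∀ n, eXZ n ≤ (pZ - ν) ^ n - (pX - ν) ^ n)
    (h1ZY : ∀ n, eZY (n + 1) ≤ eZY n * pY - (pZ - pY) * (pZ - ν) ^ n) (h2ZY : ∀ n, eZY n ≤ (pY - ν) ^ n - (pZ - ν) ^ n) :
    0 ≤ pY ∧ 0 ≤ pX - pY
      ∧ (∀ n, eXY (n + 1) ≤ eXY n * pY - (pX - pY) * (pX - ν) ^ n)
      ∧ (∀ n, eXY n ≤ (pY - ν) ^ n - (pX - ν) ^ n) := by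
  refine ⟨hY0, by linarith, fun n => ?_, fun n => ?_⟩
  · rw [hsum (n + 1), hsum n]
    have key : 0 ≤ (pZ - pY) * (((pZ - ν) ^ n - (pX - ν) ^ n) - eXZ n) := mul_nonneg hγ2 (by linarith [h2XZ n])
    nlinarith [h1XZ n, h1ZY n, key]
  · rw [hsum n]; linarith [h2XZ n, h2ZY n]

/-! ### §3 The global theorem: induction on the number of contents crossed -/

/-- **THE START-CONTENT DEFICIT RECURSION, RANK-FREE AND GLOBAL** (see the module docstring): `0 ≤ Kh_Y(N;z,z)` ∧ `0 ≤ γ` ∧ (P1) ∧ (P2). [ours] -/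
theorem hubClass_global_startClass_recursion {K : ℕ} {N : S → ℕ} {t z : S} (hK : 2 ≤ K) (hNK : ∑ v, (N v : ℝ) = K + 1) (hNt : N t = 1)
    {WX WY : S → ℝ} {accX accY : S → S → ℝ} {KhX KhY : (S → ℕ) → S → S → ℝ} {KhnX KhnY : ℕ → S → S → ℝ}
    (hWX : ∀ v, 0 < WX v) (hWY : ∀ v, 0 < WY v) (hagree : ∀ v, v ≠ t → WX v = WY v) (hWt : WY t ≤ WX t)
    (haccX : ∀ h v, accX h v = min 1 (WX h / WX v)) (haccY : ∀ h v, accY h v = min 1 (WY h / WY v))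
    (hKXoff : ∀ N' h v, h ≠ v → KhX N' h v = if N' h = 0 then 0 else (N' v : ℝ) / K * accX h v)
    (hKXdiag : ∀ N' h, KhX N' h h = 1 - ∑ v ∈ univ.erase h, KhX N' h v)
    (hKYoff : ∀ N' h v, h ≠ v → KhY N' h v = if N' h = 0 then 0 else (N' v : ℝ) / K * accY h v)
    (hKYdiag : ∀ N' h, KhY N' h h = 1 - ∑ v ∈ univ.erase h, KhY N' h v)
    (hKhnX0 : ∀ h v, KhnX 0 h v = if h = v then 1 else 0) (hKhnXs : ∀ n h v, KhnX (n + 1) h v = ∑ w, KhnX n h w * KhX N w v)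
    (hKhnY0 : ∀ h v, KhnY 0 h v = if h = v then 1 else 0) (hKhnYs : ∀ n h v, KhnY (n + 1) h v = ∑ w, KhnY n h w * KhY N w v)
    (hz : N z ≠ 0) (hzt : z ≠ t) (hzb : WX z ≤ WY t) (hza : WX z < WX t) (hthree : 2 ≤ N z ∨ ∃ w, w ≠ z ∧ w ≠ t ∧ N w ≠ 0 ∧ WX z ≤ WX w) :
    0 ≤ KhY N z z ∧ 0 ≤ KhX N z z - KhY N z z
      ∧ (∀ n, KhnY (n + 1) z z - KhnX (n + 1) z z
          ≤ (KhnY n z z - KhnX n z z) * KhY N z z - (KhX N z z - KhY N z z) * (KhX N z z - (N z : ℝ) / K) ^ n)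
      ∧ (∀ n, KhnY n z z - KhnX n z z ≤ (KhY N z z - (N z : ℝ) / K) ^ n - (KhX N z z - (N z : ℝ) / K) ^ n) := by
  classical
  suffices key : ∀ (B : ℕ) (WX WY : S → ℝ) (accX accY : S → S → ℝ) (KhX KhY : (S → ℕ) → S → S → ℝ) (KhnX KhnY : ℕ → S → S → ℝ),
      (univ.filter fun v => N v ≠ 0 ∧ WY t < WX v ∧ WX v < WX t).card ≤ B →
      (∀ v, 0 < WX v) → (∀ v, 0 < WY v) → (∀ v, v ≠ t → WX v = WY v) → WY t ≤ WX t →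
      (∀ h v, accX h v = min 1 (WX h / WX v)) → (∀ h v, accY h v = min 1 (WY h / WY v)) →
      (∀ N' h v, h ≠ v → KhX N' h v = if N' h = 0 then 0 else (N' v : ℝ) / K * accX h v) →
      (∀ N' h, KhX N' h h = 1 - ∑ v ∈ univ.erase h, KhX N' h v) →
      (∀ N' h v, h ≠ v → KhY N' h v = if N' h = 0 then 0 else (N' v : ℝ) / K * accY h v) →
      (∀ N' h, KhY N' h h = 1 - ∑ v ∈ univ.erase h, KhY N' h v) →
      (∀ h v, KhnX 0 h v = if h = v then 1 else 0) → (∀ n h v, KhnX (n + 1) h v = ∑ w, KhnX n h w * KhX N w v) →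
      (∀ h v, KhnY 0 h v = if h = v then 1 else 0) → (∀ n h v, KhnY (n + 1) h v = ∑ w, KhnY n h w * KhY N w v) →
      WX z ≤ WY t → WX z < WX t → (2 ≤ N z ∨ ∃ w, w ≠ z ∧ w ≠ t ∧ N w ≠ 0 ∧ WX z ≤ WX w) →
      0 ≤ KhY N z z ∧ 0 ≤ KhX N z z - KhY N z z
        ∧ (∀ n, KhnY (n + 1) z z - KhnX (n + 1) z z
            ≤ (KhnY n z z - KhnX n z z) * KhY N z z - (KhX N z z - KhY N z z) * (KhX N z z - (N z : ℝ) / K) ^ n)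
        ∧ (∀ n, KhnY n z z - KhnX n z z ≤ (KhY N z z - (N z : ℝ) / K) ^ n - (KhX N z z - (N z : ℝ) / K) ^ n) from
    key _ WX WY accX accY KhX KhY KhnX KhnY le_rfl hWX hWY hagree hWt haccX haccY hKXoff hKXdiag hKYoff hKYdiag hKhnX0 hKhnXs hKhnY0 hKhnYs hzb hza hthree
  intro B
  induction B with
  | zero =>
      intro WX WY accX accY KhX KhY KhnX KhnY hB hWX hWY hagree hWt haccX haccY hKXoff hKXdiag hKYoff hKYdiag hKhnX0 hKhnXs hKhnY0 hKhnYs hzb hza hthree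
      have hnone : ∀ v, N v ≠ 0 → v ≠ t → ¬ (WY t < WX v ∧ WX v < WX t) := by
        intro v hv _ hb
        have : v ∈ univ.filter fun v => N v ≠ 0 ∧ WY t < WX v ∧ WX v < WX t := mem_filter.mpr ⟨mem_univ v, hv, hb⟩
        rw [Finset.card_eq_zero.mp (Nat.le_zero.mp hB)] at this
        exact absurd this (Finset.notMem_empty v)
      exact global_startClass_base hWX hWY hagree hWt haccX haccY hK hNK hNt hKXoff hKXdiag hKYoff hKYdiag hKhnX0 hKhnXs hKhnY0 hKhnYs hnone hz hzt hzb hza hthree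
  | succ B ih =>
      intro WX WY accX accY KhX KhY KhnX KhnY hB hWX hWY hagree hWt haccX haccY hKXoff hKXdiag hKYoff hKYdiag hKhnX0 hKhnXs hKhnY0 hKhnYs hzb hza hthree
      by_cases hempty : (univ.filter fun v => N v ≠ 0 ∧ WY t < WX v ∧ WX v < WX t) = ∅
      · have hnone : ∀ v, N v ≠ 0 → v ≠ t → ¬ (WY t < WX v ∧ WX v < WX t) := by
          intro v hv _ hb
          have : v ∈ univ.filter fun v => N v ≠ 0 ∧ WY t < WX v ∧ WX v < WX t := mem_filter.mpr ⟨mem_univ v, hv, hb⟩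
          rw [hempty] at this
          exact absurd this (Finset.notMem_empty v)
        exact global_startClass_base hWX hWY hagree hWt haccX haccY hK hNK hNt hKXoff hKXdiag hKYoff hKYdiag hKhnX0 hKhnXs hKhnY0 hKhnYs hnone hz hzt hzb hza hthree
      obtain ⟨u, hu⟩ := Finset.nonempty_iff_ne_empty.mpr hempty
      have hu' := (mem_filter.mp hu).2
      have hut : u ≠ t := fun h => by rw [h] at hu'; exact lt_irrefl _ hu'.2.2
      -- a content `u` strictly between: the intermediate profile `W^Z` (`t` moved to `W_u`), its kernel and powers; then two shorter moves (verbatim from Z3)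
      obtain ⟨WZ, hWZ⟩ : ∃ WZ : S → ℝ, ∀ v, WZ v = if v = t then WX u else WX v := ⟨_, fun _ => rfl⟩
      obtain ⟨accZ, haccZ⟩ : ∃ accZ : S → S → ℝ, ∀ h v, accZ h v = min 1 (WZ h / WZ v) := ⟨_, fun _ _ => rfl⟩
      obtain ⟨offZ, hoffZ⟩ : ∃ offZ : (S → ℕ) → S → S → ℝ, ∀ N' h v, offZ N' h v = if N' h = 0 then 0 else (N' v : ℝ) / K * accZ h v := ⟨_, fun _ _ _ => rfl⟩
      obtain ⟨KhZ, hKhZ⟩ : ∃ KhZ : (S → ℕ) → S → S → ℝ, ∀ N' h v, KhZ N' h v = if h = v then 1 - ∑ v' ∈ univ.erase h, offZ N' h v' else offZ N' h v :=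
        ⟨_, fun _ _ _ => rfl⟩
      let KhnZ : ℕ → S → S → ℝ := fun n => Nat.rec (motive := fun _ => S → S → ℝ) (fun h v => if h = v then 1 else 0) (fun _ prev h v => ∑ w', prev h w' * KhZ N w' v) n
      have hKhnZ0 : ∀ h v, KhnZ 0 h v = if h = v then 1 else 0 := fun _ _ => rfl
      have hKhnZs : ∀ n h v, KhnZ (n + 1) h v = ∑ w', KhnZ n h w' * KhZ N w' v := fun _ _ _ => rfl
      have hWZpos : ∀ v, 0 < WZ v := fun v => by rw [hWZ]; split_ifs <;> exact hWX _
      have hKZoff : ∀ N' h v, h ≠ v → KhZ N' h v = if N' h = 0 then 0 else (N' v : ℝ) / K * accZ h v := fun N' h v hhv => by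
        rw [hKhZ, if_neg hhv, hoffZ]
      have hKZdiag : ∀ N' h, KhZ N' h h = 1 - ∑ v ∈ univ.erase h, KhZ N' h v := fun N' h => by
        rw [hKhZ, if_pos rfl]
        congr 1
        exact sum_congr rfl fun v hv => by rw [hKhZ, if_neg (ne_of_mem_erase hv).symm]
      have hagreeXZ : ∀ v, v ≠ t → WX v = WZ v := fun v hv => by rw [hWZ, if_neg hv]
      have hagreeZY : ∀ v, v ≠ t → WZ v = WY v := fun v hv => by rw [hWZ, if_neg hv, hagree v hv]
      have hZt : WZ t = WX u := by rw [hWZ, if_pos rfl]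
      have hZz : WZ z = WX z := by rw [hWZ, if_neg hzt]
      -- the two half-moves cross fewer contents (verbatim from Z3)
      have hBXZ : (univ.filter fun v => N v ≠ 0 ∧ WZ t < WX v ∧ WX v < WX t).card ≤ B := by
        have hsub : (univ.filter fun v => N v ≠ 0 ∧ WZ t < WX v ∧ WX v < WX t) ⊆ (univ.filter fun v => N v ≠ 0 ∧ WY t < WX v ∧ WX v < WX t).erase u := by
          intro v hv
          have hv' := (mem_filter.mp hv).2
          rw [hZt] at hv'
          refine mem_erase.mpr ⟨fun h => ?_, mem_filter.mpr ⟨mem_univ v, hv'.1, by linarith [hu'.2.1], hv'.2.2⟩⟩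
          rw [h] at hv'; exact lt_irrefl _ hv'.2.1
        have := card_le_card hsub
        rw [card_erase_of_mem hu] at this
        omega
      have hBZY : (univ.filter fun v => N v ≠ 0 ∧ WY t < WZ v ∧ WZ v < WZ t).card ≤ B := by
        have hsub : (univ.filter fun v => N v ≠ 0 ∧ WY t < WZ v ∧ WZ v < WZ t) ⊆ (univ.filter fun v => N v ≠ 0 ∧ WY t < WX v ∧ WX v < WX t).erase u := by
          intro v hv
          have hv' := (mem_filter.mp hv).2
          have hvt : v ≠ t := fun h => by rw [h] at hv'; exact lt_irrefl _ hv'.2.2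
          rw [hZt, ← hagreeXZ v hvt] at hv'
          refine mem_erase.mpr ⟨fun h => ?_, mem_filter.mpr ⟨mem_univ v, hv'.1, hv'.2.1, by linarith [hu'.2.2]⟩⟩
          rw [h] at hv'; exact lt_irrefl _ hv'.2.2
        have := card_le_card hsub
        rw [card_erase_of_mem hu] at this
        omega
      -- the hypotheses at the hub for the two half-moves
      have hzbXZ : WX z ≤ WZ t := by rw [hZt]; linarith [hu'.2.1]
      have hzbZY : WZ z ≤ WY t := by rw [hZz]; exact hzb
      have hzaZY : WZ z < WZ t := by rw [hZz, hZt]; linarith [hu'.2.1]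
      have hthreeZ : 2 ≤ N z ∨ ∃ w, w ≠ z ∧ w ≠ t ∧ N w ≠ 0 ∧ WZ z ≤ WZ w := by
        rcases hthree with h2 | ⟨w, hwz, hwt, hw, hzw⟩
        · exact Or.inl h2
        · exact Or.inr ⟨w, hwz, hwt, hw, by rw [hZz, ← hagreeXZ w hwt]; exact hzw⟩
      -- the two half-moves
      have h1 := ih WX WZ accX accZ KhX KhZ KhnX KhnZ hBXZ hWX hWZpos hagreeXZ (by rw [hZt]; exact hu'.2.2.le) haccX haccZ hKXoff hKXdiag hKZoff hKZdiag
        hKhnX0 hKhnXs hKhnZ0 hKhnZs hzbXZ hza hthree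
      have h2 := ih WZ WY accZ accY KhZ KhY KhnZ KhnY hBZY hWZpos hWY hagreeZY (by rw [hZt]; exact hu'.2.1.le) haccZ haccY hKZoff hKZdiag hKYoff hKYdiag
        hKhnZ0 hKhnZs hKhnY0 hKhnYs hzbZY hzaZY hthreeZ
      obtain ⟨_, hγ1, h1XZ, h2XZ⟩ := h1
      obtain ⟨hY0, hγ2, h1ZY, h2ZY⟩ := h2
      exact global_startClass_chain (eXZ := fun n => KhnZ n z z - KhnX n z z) (eZY := fun n => KhnY n z z - KhnZ n z z)
        (eXY := fun n => KhnY n z z - KhnX n z z) (ν := (N z : ℝ) / K) (fun n => by ring) hY0 hγ1 hγ2 h1XZ h2XZ h1ZY h2ZY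

end GlobalDeficit

end Summit.Ventures.LatticeQCDFlow.Scaling
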